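import Summits.PneNP.PneNP.Theorems.ConvexRankGatesConvexGateBlindExactLiftingTriangleLineCover
import Mathlib.LinearAlgebra.FiniteDimensional.Lemmas
import Mathlib.LinearAlgebra.Dimension.RankNullity

/-!
# Triangle instance — the INTERACTION-SPAN lemma: near-minimal factorisations are almost interaction-free (lead c6)

Support file for crux `ConvexGateBlind` (stmt-PneNP-10680), line `xor-door-perfect-completeness`, open stub
`stub_exactLifting`; companion of the Mono-heaviness calculus (`…TriangleMonoHeavy`, `…TriangleTwoDirBlind`).

Every row `w ↦ monoCount x w − ε` of the shifted triangle matrix is INTERACTION-FREE — a sum of three tables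
`f(a,b) + g(b,d) + h(a,d)` (`row_interactionFree`).  Consequently (`interaction_span_bound`): in ANY factorisation
`monoCount x w − ε = ∑_{l<D} U x l · V l w` (real coefficients of any sign, any number `D` of terms) and for ANY linear map
`Φ` that vanishes on interaction-free functions (e.g. the quotient by them, or the family of alternating `2×2×2` cube sums),

  `dim span{Φ(V l)} + dim span{rows} ≤ D`.

So the 3-way-interaction parts of the `D` column atoms span at most `D − rank(M_t − εJ)` dimensions
(`rank(M_t − εJ) = 3t² − 3t + 1`, the dimension of the interaction-free functions, since the rows span them): a
factorisation with `rank + k` terms has atoms that are interaction-free modulo a `k`-dimensional space.  This is the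
structural entry point of the conditional super-rank bound of memo `ExactLifting-c6.md` (with LEMMA N: interaction
budget `k ≥ Ω(t / log t)` uniformly in `ε`), and it is what makes the no-lift model (all atoms interaction-free,
`k = 0`) the `D = rank` extreme of the general question.  Proof: rank–nullity for `Φ ∘ T`, `T c = ∑_l c_l V_l`; the
coefficient rows `U x` lie in `ker (Φ ∘ T)`, which `T` maps onto a space containing every row.

Nothing here is cited; everything is elementary linear algebra.
-/

set_option linter.dupNamespace false -- `Summit.PneNP.PneNP.…`: summit = sub-problem (D-0017)

namespace Summit.PneNP.PneNP.Theorems.XorDoor.TriLine.Heavy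

open Finset

noncomputable section

variable {t : ℕ}

/-- `v` is interaction-free: a sum of three tables, one per pair of coordinates. -/
def InteractionFree (v : Tri t → ℝ) : Prop :=
  ∃ f g h : Fin t → Fin t → ℝ, ∀ a b d, v (a, b, d) = f a b + g b d + h a d

/-- **Every shifted row of the triangle matrix is interaction-free**: `monoCount x (a,b,d) − ε =
([x₁a = x₂b] − ε) + [x₂b = x₃d] + [x₁a = x₃d]`. -/
theorem row_interactionFree (x : Col t) (ε : ℝ) : InteractionFree (fun w => (monoCount x w : ℝ) - ε) := by
  refine ⟨fun a b => (if x.1 a = x.2.1 b then 1 else 0) - ε, fun b d => if x.2.1 b = x.2.2 d then 1 else 0,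
    fun a d => if x.1 a = x.2.2 d then 1 else 0, fun a b d => ?_⟩
  simp only [monoCount]
  push_cast
  ring

/-- interaction-free functions form a submodule: here only what is needed — a linear map killing every sum of three
tables kills every interaction-free function (by definition) -/
lemma map_eq_zero_of_interactionFree {W : Type*} [AddCommGroup W] [Module ℝ W] (Φ : (Tri t → ℝ) →ₗ[ℝ] W)
    (hΦ : ∀ f g h : Fin t → Fin t → ℝ, Φ (fun w => f w.1 w.2.1 + g w.2.1 w.2.2 + h w.1 w.2.2) = 0)
    {v : Tri t → ℝ} (hv : InteractionFree v) : Φ v = 0 := by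
  obtain ⟨f, g, h, hv⟩ := hv
  have : v = fun w => f w.1 w.2.1 + g w.2.1 w.2.2 + h w.1 w.2.2 := by
    funext w
    exact hv w.1 w.2.1 w.2.2
  rw [this]
  exact hΦ f g h

/-- the synthesis map of a family of atoms: coefficients `c` ↦ the combination `∑_l c_l V_l` -/
def synth {D : ℕ} (V : Fin D → Tri t → ℝ) : (Fin D → ℝ) →ₗ[ℝ] (Tri t → ℝ) where
  toFun c := fun w => ∑ l, c l * V l w
  map_add' c c' := by
    funext w
    simp only [Pi.add_apply, add_mul, sum_add_distrib]
  map_smul' r c := by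
    funext w
    simp only [Pi.smul_apply, smul_eq_mul, RingHom.id_apply, mul_sum, mul_assoc]

/-- the synthesis map sends the `l`-th coordinate vector to the `l`-th atom -/
lemma synth_single {D : ℕ} (V : Fin D → Tri t → ℝ) (l : Fin D) : synth V (Pi.single l 1) = V l := by
  funext w
  simp only [synth, LinearMap.coe_mk, AddHom.coe_mk]
  rw [sum_eq_single l]
  · simp
  · intro l' _ hl'
    simp [hl']
  · intro h; exact absurd (mem_univ l) h

/-- **Interaction-span lemma.**  In any factorisation `monoCount x w − ε = ∑_l U x l · V l w` of the shifted triangle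
matrix (real coefficients, any signs, any number `D` of terms), for any linear map `Φ` vanishing on interaction-free
functions, the images `Φ(V l)` of the atoms and the rows together span at most `D` dimensions:
`dim span{Φ(V l)} + dim span{rows} ≤ D`. -/
theorem interaction_span_bound {D : ℕ} {W : Type*} [AddCommGroup W] [Module ℝ W] (Φ : (Tri t → ℝ) →ₗ[ℝ] W)
    (hΦ : ∀ f g h : Fin t → Fin t → ℝ, Φ (fun w => f w.1 w.2.1 + g w.2.1 w.2.2 + h w.1 w.2.2) = 0)
    (U : Col t → Fin D → ℝ) (V : Fin D → Tri t → ℝ) (ε : ℝ)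
    (hfact : ∀ x w, (monoCount x w : ℝ) - ε = ∑ l, U x l * V l w) :
    Module.finrank ℝ (Submodule.span ℝ (Set.range fun l => Φ (V l))) +
      Module.finrank ℝ (Submodule.span ℝ (Set.range fun x : Col t => fun w => (monoCount x w : ℝ) - ε)) ≤ D := by
  set T := synth V with hTdef
  set Ψ : (Fin D → ℝ) →ₗ[ℝ] W := Φ.comp T with hΨ
  -- (1) the images of the atoms lie in the range of `Ψ`
  have h1 : Submodule.span ℝ (Set.range fun l => Φ (V l)) ≤ LinearMap.range Ψ := by
    rw [Submodule.span_le]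
    rintro _ ⟨l, rfl⟩
    refine ⟨Pi.single l 1, ?_⟩
    simp only [hΨ, LinearMap.comp_apply, hTdef, synth_single]
  -- (2) every row is `T` of its coefficient vector, which lies in `ker Ψ`
  have h2 : Submodule.span ℝ (Set.range fun x : Col t => fun w => (monoCount x w : ℝ) - ε)
      ≤ Submodule.map T (LinearMap.ker Ψ) := by
    rw [Submodule.span_le]
    rintro _ ⟨x, rfl⟩
    have hrow : (fun w => (monoCount x w : ℝ) - ε) = T (U x) := by
      funext w
      simp only [hTdef, synth, LinearMap.coe_mk, AddHom.coe_mk]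
      exact hfact x w
    refine ⟨U x, ?_, hrow.symm⟩
    show U x ∈ LinearMap.ker Ψ
    rw [LinearMap.mem_ker, hΨ, LinearMap.comp_apply, ← hrow]
    exact map_eq_zero_of_interactionFree Φ hΦ (row_interactionFree x ε)
  -- (3) rank–nullity for `Ψ`
  have h3 : Module.finrank ℝ (LinearMap.range Ψ) + Module.finrank ℝ (LinearMap.ker Ψ) = D := by
    rw [LinearMap.finrank_range_add_finrank_ker]
    simp
  have h4 : Module.finrank ℝ (Submodule.map T (LinearMap.ker Ψ)) ≤ Module.finrank ℝ (LinearMap.ker Ψ) :=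
    Submodule.finrank_map_le T _
  have h5 := Submodule.finrank_mono h1
  have h6 := Submodule.finrank_mono h2
  omega

/-- **Interaction-span lemma, registered form** (sub-goal `triangle_interaction_span` of stmt-PneNP-10680). -/
theorem triangle_interaction_span : ∀ {t D : ℕ} {W : Type} [AddCommGroup W] [Module ℝ W] (Φ : (Tri t → ℝ) →ₗ[ℝ] W), (∀ f g h : Fin t → Fin t → ℝ, Φ (fun w => f w.1 w.2.1 + g w.2.1 w.2.2 + h w.1 w.2.2) = 0) → ∀ (U : Col t → Fin D → ℝ) (V : Fin D → Tri t → ℝ) (ε : ℝ), (∀ x w, (monoCount x w : ℝ) - ε = ∑ l, U x l * V l w) → Module.finrank ℝ (Submodule.span ℝ (Set.range fun l => Φ (V l))) + Module.finrank ℝ (Submodule.span ℝ (Set.range fun x : Col t => fun w => (monoCount x w : ℝ) - ε)) ≤ D :=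
  fun Φ hΦ U V ε hfact => interaction_span_bound Φ hΦ U V ε hfact

end

end Summit.PneNP.PneNP.Theorems.XorDoor.TriLine.Heavy
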